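import Summits.RiemannHypothesis.RiemannHypothesis.Theorems.SigmaLW0Band
import HarnessLib

/-!
# SigmaL / BC5 rung W0 — soundness of the banded main-sum evaluator (`mem_bandW`)

Route `RiemannHypothesis/HardyZLehmerSplit`, item `SigmaL` (stmt-RiemannHypothesis-24253), tribunal
seat `rh-trib-w-sigmaL-1`. COMPUTATIONAL SUPPORT ONLY: nothing in this file bears on the truth of the
Riemann Hypothesis or of `SigmaL`.

Continuation of `Theorems/SigmaLW0Band.lean` (definitions `addMoments`, `blockLoop`, `bandMoments`,
`taylorSum`, `bandW` and their step lemmas): here the Taylor-band identity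
`n^{-1/2-i(t₀+δ)} = c_n e^{-iδℓ_b} e^{-iδ(log n − ℓ_b)}`, the remainder bound for `e^{iy}`
(`Complex.exp_bound`), and the main inclusion **`mem_bandW`**: `W_N(t₀+δ) ∈ bandW …` (as `RSEval.Wsum`).

[cite: Gabcke1979, Einleitung (1) p. 2]; [cite: Brent1979, §3]; interval inclusion [folklore].
-/

set_option linter.dupNamespace false
set_option autoImplicit false

open Finset Complex
open Literature.Analysis.ValidatedNumerics Literature.Analysis.ValidatedNumerics.NumericsMP
open Literature.NumberTheory.LFunctions Literature.NumberTheory.LFunctions.ZetaNumerics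
open Literature.NumberTheory.LFunctions.RSEval

namespace Summit.RiemannHypothesis.RiemannHypothesis.Theorems.SigmaLCert

section Soundness

/-- `n^{-(1/2+it)} = c_n(t₀) · e^{-iδℓ} · e^{-iδ(log n − ℓ)}` for `t = t₀ + δ`, `n ≥ 1`. [folklore] -/
lemma cpow_eq_cTerm_mul {n : ℕ} (hn : 1 ≤ n) (t₀ δ ℓ : ℝ) :
    (n : ℂ) ^ (-(1 / 2 + ((t₀ + δ : ℝ) : ℂ) * I)) =
      cTerm t₀ n * Complex.exp ((((-(δ * ℓ)) : ℝ) : ℂ) * I) *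
        Complex.exp ((((-(δ * (Real.log n - ℓ))) : ℝ) : ℂ) * I) := by
  have hn0 : (n : ℂ) ≠ 0 := by exact_mod_cast (by omega : n ≠ 0)
  rw [Complex.cpow_def_of_ne_zero hn0, ← Complex.natCast_log, cTerm, Complex.ofReal_exp,
    ← Complex.exp_add, ← Complex.exp_add, ← Complex.exp_add]
  congr 1
  push_cast
  ring

/-- Taylor remainder of `e^{iy}`, `|y| ≤ 1`, `J ≥ 1` terms (`Complex.exp_bound`). [folklore] -/
lemma norm_exp_sub_taylor_le {y : ℝ} (hy : |y| ≤ 1) {J : ℕ} (hJ : 0 < J) :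
    ‖Complex.exp (((y : ℝ) : ℂ) * I) - ∑ j ∈ range J, (((y : ℝ) : ℂ) * I) ^ j / (j.factorial : ℂ)‖ ≤
      |y| ^ J * ((J + 1 : ℝ) / (J.factorial * J)) := by
  have hn : ‖((y : ℂ) * I)‖ = |y| := by simp
  have hx : ‖((y : ℂ) * I)‖ ≤ 1 := hn ▸ hy
  have := Complex.exp_bound hx hJ
  rw [hn] at this
  convert this using 2
  push_cast
  rw [div_eq_mul_inv]

/-- **Soundness of the banded main sum.** For valid tables, `t₀ ∈ t0I`, `δ ∈ δI`, block sizes from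
`n ≥ 1` within the table, `bandMoments … = some D` and `bandW … D = some W`:
`Σ_{n ≤ k < n + Σ sizes} k^{-(1/2 + i(t₀+δ))} ∈ W`. [cite: Gabcke1979, Einleitung (1) p. 2] -/
theorem mem_bandW_from {R : RSTables} (hR : R.Valid) {t₀ δ : ℝ} {t0I δI : MI}
    (ht : MI.mem R.T.S t₀ t0I) (hδ : MI.mem R.T.S δ δI) {J : ℕ} :
    ∀ (sizes : List ℕ) (n : ℕ) {D : List (MI × List MC × MI × ℤ)} {W : MC},
      1 ≤ n → n + sizes.sum ≤ R.T.N + 1 →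
      bandMoments R t0I J n sizes = some D → bandW R δI J D = some W →
      MC.mem R.T.S (∑ k ∈ Finset.Ico n (n + sizes.sum),
        (k : ℂ) ^ (-(1 / 2 + ((t₀ + δ : ℝ) : ℂ) * I))) W
  | [], n, D, W, _, _, hD, hW => by
    simp only [bandMoments, Option.some.injEq] at hD
    subst hD
    simp only [bandW, Option.some.injEq] at hW
    subst hW
    simpa using MC.mem_ofInt R.T.S 0
  | sz :: rest, n, D, W, hn, hN, hD, hW => by
    have hS := hR.T_valid.S_pos
    have hSr : (0 : ℝ) < R.T.S := by exact_mod_cast hS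
    simp only [bandMoments] at hD
    split_ifs at hD with hsz
    split at hD
    rotate_left
    · simp at hD
    rename_i out tail hout htail
    simp only [Option.some.injEq] at hD
    subst hD
    simp only [bandW] at hW
    split at hW
    rotate_left
    · simp at hW
    rename_i ph acc hph hacc
    split_ifs at hW with hc
    obtain ⟨hx0, hxS, hBhi, hMlen, hJ⟩ := hc
    simp only [Option.some.injEq] at hW
    subst hW
    simp only [List.sum_cons] at hN ⊢
    have hsz1 : 1 ≤ sz := Nat.one_le_iff_ne_zero.2 hsz
    have hnN : n ≤ R.T.N := by omega
    -- the tail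
    have IH := mem_bandW_from hR ht hδ rest (n + sz) (by omega) (by simpa [add_assoc] using hN) htail hacc
    -- the block: moments
    set ℓ : ℝ := Real.log n with hℓdef
    have hℓ : MI.mem R.T.S ℓ (R.T.logs.getD n default) := hR.T_valid.mem_logs n hn hnN
    have h0M : ∀ j, j < J → MC.mem R.T.S ((fun _ ↦ (0 : ℂ)) j)
        ((List.replicate J (MC.ofInt R.T.S 0)).getD j default) := by
      intro j hj
      rw [List.getD_replicate _ hj]
      simpa using MC.mem_ofInt R.T.S 0
    obtain ⟨hlenM, hmom, hB, -, heps⟩ := blockLoop_spec hR ht hℓ sz n _ _ 0 (fun _ ↦ (0 : ℂ)) 0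
      hn (by omega) (by simp) h0M (by simpa using MI.mem_ofInt R.T.S 0) hout
    simp only [zero_add] at hmom hB
    -- names
    set u : ℕ → ℝ := fun k ↦ Real.log ((n + k : ℕ) : ℝ) - ℓ with hudef
    set y : ℕ → ℝ := fun k ↦ -(δ * u k) with hydef
    set x : ℤ := Numerics.cdiv (δI.absHi * out.2.2) R.T.S with hxdef
    set Mv : ℕ → ℂ := fun j ↦ ∑ k ∈ range sz, cTerm t₀ (n + k) * ((u k : ℝ) : ℂ) ^ j with hMv
    set Tk : ℕ → ℂ := fun k ↦ ∑ j ∈ range J, (((y k : ℝ) : ℂ) * I) ^ j / (j.factorial : ℂ) with hTk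
    set rk : ℕ → ℂ := fun k ↦ Complex.exp (((y k : ℝ) : ℂ) * I) - Tk k with hrk
    set E : ℂ := ∑ k ∈ range sz, cTerm t₀ (n + k) * rk k with hE
    set P : ℂ := Complex.exp ((((-(δ * ℓ)) : ℝ) : ℂ) * I) with hP
    -- |δ u_k| ≤ x / S ≤ 1
    have hδabs : |δ| * R.T.S ≤ (δI.absHi : ℝ) := MI.abs_le_absHi hδ
    have hxge : (δI.absHi : ℝ) * out.2.2 / R.T.S ≤ (x : ℝ) := by
      have := Numerics.div_le_cdiv (a := δI.absHi * out.2.2) (b := (R.T.S : ℤ)) (by exact_mod_cast hS)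
      push_cast at this
      exact this
    have hA0 : (0 : ℝ) ≤ (δI.absHi : ℝ) := le_trans (by positivity) hδabs
    have hyk : ∀ k, k < sz → |y k| ≤ (x : ℝ) / R.T.S := by
      intro k hk
      have h1 := heps k hk
      have habs : |y k| = |δ| * |u k| := by rw [hydef]; simp [abs_mul]
      rw [habs, le_div_iff₀ hSr]
      have h2 : |δ| * |u k| * ((R.T.S : ℝ) * R.T.S) ≤ (δI.absHi : ℝ) * out.2.2 := by
        calc |δ| * |u k| * ((R.T.S : ℝ) * R.T.S) = (|δ| * R.T.S) * (|u k| * R.T.S) := by ring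
          _ ≤ (δI.absHi : ℝ) * out.2.2 := mul_le_mul hδabs h1 (by positivity) hA0
      have h3 : (δI.absHi : ℝ) * out.2.2 ≤ (x : ℝ) * R.T.S := by
        rw [div_le_iff₀ hSr] at hxge; exact hxge
      have h4 : |δ| * |u k| * R.T.S * R.T.S ≤ (x : ℝ) * R.T.S := by
        have : |δ| * |u k| * ((R.T.S : ℝ) * R.T.S) = |δ| * |u k| * R.T.S * R.T.S := by ring
        linarith [h2, h3, this]
      exact le_of_mul_le_mul_right h4 hSr
    have hx1 : (x : ℝ) / R.T.S ≤ 1 := by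
      rw [div_le_one hSr]; exact_mod_cast hxS
    have hx0r : (0 : ℝ) ≤ (x : ℝ) / R.T.S := by
      have : (0 : ℝ) ≤ x := by exact_mod_cast hx0
      positivity
    -- the block sum identity
    have hterm : ∀ k ∈ range sz, ((n + k : ℕ) : ℂ) ^ (-(1 / 2 + ((t₀ + δ : ℝ) : ℂ) * I)) =
        P * (cTerm t₀ (n + k) * (Tk k + rk k)) := by
      intro k _
      have := cpow_eq_cTerm_mul (n := n + k) (by omega) t₀ δ ℓ
      simp only [this, hrk, hydef, hudef, hP]
      ring
    have hT : ∀ k ∈ range sz, cTerm t₀ (n + k) * Tk k =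
        ∑ i ∈ range J, kval δ i * (cTerm t₀ (n + k) * ((u k : ℝ) : ℂ) ^ i) := by
      intro k _
      rw [hTk, Finset.mul_sum]
      refine Finset.sum_congr rfl fun i _ ↦ ?_
      rw [kval, hydef]
      push_cast
      ring
    have hswap : ∑ k ∈ range sz, cTerm t₀ (n + k) * Tk k = ∑ i ∈ range J, kval δ i * Mv i := by
      rw [Finset.sum_congr rfl hT, Finset.sum_comm]
      refine Finset.sum_congr rfl fun i _ ↦ ?_
      rw [hMv, Finset.mul_sum]
    have hblock : ∑ k ∈ Finset.Ico n (n + sz), (k : ℂ) ^ (-(1 / 2 + ((t₀ + δ : ℝ) : ℂ) * I)) =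
        P * ((∑ i ∈ range J, kval δ i * Mv i) + E) := by
      rw [Finset.sum_Ico_eq_sum_range, show n + sz - n = sz by omega,
        Finset.sum_congr rfl hterm, ← Finset.mul_sum, ← hswap, hE, ← Finset.sum_add_distrib]
      congr 1
      exact Finset.sum_congr rfl fun k _ ↦ by ring
    -- |E| ≤ (x/S)^J κ (B.hi/S)
    have hEle : ‖E‖ * R.T.S ≤ (out.2.1.hi : ℝ) * ((x : ℝ) / R.T.S) ^ J *
        ((J + 1 : ℝ) / (J.factorial * J)) := by
      have hκ : (0 : ℝ) ≤ (J + 1 : ℝ) / (J.factorial * J) := by positivity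
      have h1 : ‖E‖ ≤ ∑ k ∈ range sz, Real.exp (-(Real.log ((n + k : ℕ) : ℝ) / 2)) *
          (((x : ℝ) / R.T.S) ^ J * ((J + 1 : ℝ) / (J.factorial * J))) := by
        refine (norm_sum_le _ _).trans (Finset.sum_le_sum fun k hk ↦ ?_)
        rw [norm_mul]
        have hc : ‖cTerm t₀ (n + k)‖ = Real.exp (-(Real.log ((n + k : ℕ) : ℝ) / 2)) := by
          rw [cTerm, norm_mul, Complex.norm_exp_ofReal_mul_I, one_mul, Complex.norm_real,
            Real.norm_eq_abs, abs_of_pos (Real.exp_pos _)]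
        rw [hc]
        refine mul_le_mul_of_nonneg_left ?_ (Real.exp_pos _).le
        have hyk' := hyk k (Finset.mem_range.1 hk)
        have := norm_exp_sub_taylor_le (hyk'.trans hx1) hJ
        refine this.trans (mul_le_mul_of_nonneg_right ?_ hκ)
        exact pow_le_pow_left₀ (abs_nonneg _) hyk' J
      rw [← Finset.sum_mul] at h1
      have h2 : (∑ k ∈ range sz, Real.exp (-(Real.log ((n + k : ℕ) : ℝ) / 2))) * R.T.S ≤ out.2.1.hi :=
        hB.2
      have h3 : (0 : ℝ) ≤ ((x : ℝ) / R.T.S) ^ J * ((J + 1 : ℝ) / (J.factorial * J)) := by positivity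
      calc ‖E‖ * R.T.S ≤ (∑ k ∈ range sz, Real.exp (-(Real.log ((n + k : ℕ) : ℝ) / 2))) *
            (((x : ℝ) / R.T.S) ^ J * ((J + 1 : ℝ) / (J.factorial * J))) * R.T.S :=
            mul_le_mul_of_nonneg_right h1 hSr.le
        _ = ((∑ k ∈ range sz, Real.exp (-(Real.log ((n + k : ℕ) : ℝ) / 2))) * R.T.S) *
            (((x : ℝ) / R.T.S) ^ J * ((J + 1 : ℝ) / (J.factorial * J))) := by ring
        _ ≤ (out.2.1.hi : ℝ) * (((x : ℝ) / R.T.S) ^ J * ((J + 1 : ℝ) / (J.factorial * J))) :=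
            mul_le_mul_of_nonneg_right h2 h3
        _ = _ := by ring
    -- rad ≥ |E| S
    have hrad : ‖E‖ * R.T.S ≤ ((Numerics.cdiv (Numerics.cdiv (out.2.1.hi * x ^ J) ((R.T.S : ℤ) ^ J) *
        (J + 1)) (J.factorial * J) : ℤ) : ℝ) := by
      have hSJ : (0 : ℤ) < (R.T.S : ℤ) ^ J := by positivity
      have hJJ : (0 : ℤ) < (J.factorial : ℤ) * J := by exact_mod_cast mul_pos (Nat.factorial_pos J) hJ
      have hS0 : (R.T.S : ℝ) ≠ 0 := hSr.ne'
      have e1 := Numerics.div_le_cdiv (a := out.2.1.hi * x ^ J) hSJ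
      have e2 := Numerics.div_le_cdiv
        (a := Numerics.cdiv (out.2.1.hi * x ^ J) ((R.T.S : ℤ) ^ J) * (J + 1)) hJJ
      refine hEle.trans (le_trans ?_ e2)
      push_cast
      rw [le_div_iff₀ (by exact_mod_cast mul_pos (Nat.factorial_pos J) hJ)]
      have hJ1 : (0 : ℝ) ≤ (J : ℝ) + 1 := by positivity
      have e1' : (out.2.1.hi : ℝ) * (x : ℝ) ^ J / (R.T.S : ℝ) ^ J * ((J : ℝ) + 1) ≤
          ((Numerics.cdiv (out.2.1.hi * x ^ J) ((R.T.S : ℤ) ^ J) : ℤ) : ℝ) * ((J : ℝ) + 1) := by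
        push_cast at e1
        exact mul_le_mul_of_nonneg_right e1 hJ1
      have hfac : (0 : ℝ) < (J.factorial : ℝ) * J := by exact_mod_cast mul_pos (Nat.factorial_pos J) hJ
      have hfac0 : (J.factorial : ℝ) * J ≠ 0 := hfac.ne'
      calc (out.2.1.hi : ℝ) * ((x : ℝ) / R.T.S) ^ J * ((J + 1 : ℝ) / (J.factorial * J)) *
            ((J.factorial : ℝ) * J)
          = (out.2.1.hi : ℝ) * (x : ℝ) ^ J / (R.T.S : ℝ) ^ J * ((J : ℝ) + 1) := by
            rw [div_pow]; field_simp
        _ ≤ _ := e1'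
    -- assemble
    have hK0 : MC.mem R.T.S (kval δ 0) (MC.ofInt R.T.S 1) := by
      simpa [kval] using MC.mem_ofInt R.T.S 1
    have hinner0 := taylorSum_spec hS hδ Mv out.1 0 (MC.ofInt R.T.S 1) (MC.ofInt R.T.S 0) 0 hK0
      (by simpa using MC.mem_ofInt R.T.S 0)
      (fun i hi ↦ by rw [zero_add]; simp only [hMv, hudef]; exact hmom i (hlenM ▸ hi))
    simp only [zero_add, hlenM] at hinner0
    have hinner : MC.mem R.T.S ((∑ i ∈ range J, kval δ i * Mv i) + E)
        ((taylorSum R.T.S δI 0 (MC.ofInt R.T.S 1) out.1 (MC.ofInt R.T.S 0)).widen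
          (Numerics.cdiv (Numerics.cdiv (out.2.1.hi * x ^ J) ((R.T.S : ℤ) ^ J) * (J + 1))
            (J.factorial * J))) :=
      MC.mem_widen hinner0 (by simpa using hrad)
    have hPm : MC.mem R.T.S P ph :=
      MC.mem_expI hS hR.T_valid.mem_pi hph (MI.mem_neg (MI.mem_mul hS hδ hℓ))
    have hblockmem := MC.mem_mul hS hPm hinner
    rw [← hblock] at hblockmem
    have := MC.mem_add IH hblockmem
    rw [add_comm] at this
    convert this using 2
    rw [← add_assoc]
    exact (Finset.sum_Ico_consecutive _ (by omega) (by omega)).symm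

/-- **Soundness of the banded main sum, `RSEval.Wsum` form**: with blocks covering `1 … N`,
`W_N(t₀ + δ) ∈ bandW …`. [cite: Gabcke1979, Einleitung (1) p. 2] -/
theorem mem_bandW {R : RSTables} (hR : R.Valid) {t₀ δ : ℝ} {t0I δI : MI}
    (ht : MI.mem R.T.S t₀ t0I) (hδ : MI.mem R.T.S δ δI) {J N : ℕ} {sizes : List ℕ}
    (hsum : sizes.sum = N) (hN : N ≤ R.T.N) {D : List (MI × List MC × MI × ℤ)} {W : MC}
    (hD : bandMoments R t0I J 1 sizes = some D) (hW : bandW R δI J D = some W) :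
    MC.mem R.T.S (Wsum N (t₀ + δ)) W := by
  have := mem_bandW_from hR ht hδ sizes 1 le_rfl (by omega) hD hW
  rw [hsum] at this
  unfold Wsum
  convert this using 2
  ext k
  simp only [Finset.mem_Icc, Finset.mem_Ico]
  omega

end Soundness

end Summit.RiemannHypothesis.RiemannHypothesis.Theorems.SigmaLCert
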